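import Mathlib

/-!
# Level-1 pointwise bound, group RT: the density and temperature pairings at one direction

Helper file for the line `log-lipschitz-budget` of the crux
`ImplosionDichotomy.PolynomialCompression` (stub `stub_logBudgetShadowing`, blueprint §4,
level 1), used by `level1_groupRT_pointwise_bound` (file `…Level1GroupRTPointwise.lean`).
At one space-time point and for one direction `l`, write `x = a'ₗ = ∂ₗδρ`, `y = b'ₗ = ∂ₗδθ`,
`vᵢ = w'ₗᵢ = ∂ₗδuᵢ` (level 1), `a = ρ − c₁³`, `b = θ − K c₁²`, `w = δu` (level 0), weights
`A = θ(ζ0 + ζ1)/ρ`, `B = 3ρ/(2θ)`, Type-I scale `ε = C/λ` (`|D| ≤ 3ε` for `D = div u₁`,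
`|dcᵢ| ≤ ε` for the reference gradient), reference second-derivative envelope `R_v`
(`|S| ≤ 3 R_v` for `S = Σᵢ ∂ₗ∂ᵢu₁ᵢ`, `|P|, |Q| ≤ 3 N R_v` for `Σᵢ wᵢ ∂ₗ∂ᵢρ₁`, `Σᵢ wᵢ ∂ₗ∂ᵢθ₁`
with `N = |w|`), weighted level-0 sizes `ma = √A |a|`, `mw = √ρ N`, `mb = √B |b|`, and an
energy `E ≥ ½ (A x² + ρ Σ vᵢ² + B y²)`.

* `level1_groupRT_density_pairing_le`: the density pairing
  `A x (−x D − a S − Σᵢ vᵢ ∂ᵢρ₁ − P)` is `≤ (Type I) · (A x², ρ Σ vᵢ²) + (R_v-monomials)(ma, mw) √E`;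
* `level1_groupRT_temperature_pairing_le`: the temperature pairing
  `B y (−Σᵢ vᵢ ∂ᵢθ₁ − Q − ⅔ (∂θ ζ0 + θ ζ1 ∂ρ/ρ − ∂θ₁) D − ⅔ (θ ζ0 − K c₁²) S)` is bounded the
  same way, the EOS defects `ζ0 − 1`, `ζ1 = O(c_Z ρ σ³)` producing the `σ³ √E` forcings.

Two level-1 factors are absorbed by weighted AM–GM (`rt_cross_le`), one level-1 factor against a
coefficient by `F x ≤ M √E ⇐ 2F² ≤ Q M²` (`rt_forcing_le`); all coefficient comparisons are
polynomial identities with nonnegative remainders.  Pure real-number inequalities.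
-/

namespace Summit.AtomisticToContinuum.HydrodynamicLimit.Theorems

/-! ### Elementary absorption lemmas (as in the level-0 file) -/

/-- AM–GM absorption of a cross term `κ x y` into `L · ½ (P x² + Q y²)` when `κ² ≤ L² P Q`. -/
private lemma rt_cross_le {P Q L κ x y : ℝ} (hP : 0 < P) (hL : 0 ≤ L)
    (hκ : κ ^ 2 ≤ L ^ 2 * P * Q) : κ * x * y ≤ L * (1 / 2 * (P * x ^ 2 + Q * y ^ 2)) := by
  rcases hL.eq_or_lt with hL0 | hLpos
  · have hκ0 : κ = 0 := by
      rw [← hL0] at hκ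
      nlinarith [sq_nonneg κ]
    simp [hκ0, ← hL0]
  · have key : 0 ≤ (L * P * x - κ * y) ^ 2 + (L ^ 2 * P * Q - κ ^ 2) * y ^ 2 := by
      linarith [sq_nonneg (L * P * x - κ * y), mul_nonneg (sub_nonneg.2 hκ) (sq_nonneg y)]
    have hLP : 0 < L * P := mul_pos hLpos hP
    have hid : (L * P) * (2 * (L * (1 / 2 * (P * x ^ 2 + Q * y ^ 2)) - κ * x * y))
        = (L * P * x - κ * y) ^ 2 + (L ^ 2 * P * Q - κ ^ 2) * y ^ 2 := by ring
    have h3 : 0 ≤ 2 * (L * (1 / 2 * (P * x ^ 2 + Q * y ^ 2)) - κ * x * y) := by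
      refine (mul_nonneg_iff_of_pos_left hLP).1 ?_
      rw [hid]; exact key
    linarith

/-- A forcing `F x` is bounded by `M √E` when `Q x² ≤ 2E` and `2F² ≤ Q M²`. -/
private lemma rt_forcing_le {F x Q E M : ℝ} (hQ : 0 < Q) (hM : 0 ≤ M)
    (hx : Q * x ^ 2 ≤ 2 * E) (hF : 2 * F ^ 2 ≤ Q * M ^ 2) : F * x ≤ M * Real.sqrt E := by
  have h1 : (F * x) ^ 2 ≤ M ^ 2 * E := by
    refine le_of_mul_le_mul_left ?_ hQ
    calc Q * (F * x) ^ 2 = F ^ 2 * (Q * x ^ 2) := by ring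
      _ ≤ F ^ 2 * (2 * E) := by gcongr
      _ = 2 * F ^ 2 * E := by ring
      _ ≤ Q * M ^ 2 * E := by
          have hE : 0 ≤ E := by nlinarith [mul_nonneg hQ.le (sq_nonneg x)]
          exact mul_le_mul_of_nonneg_right hF hE
      _ = Q * (M ^ 2 * E) := by ring
  calc F * x ≤ |F * x| := le_abs_self _
    _ ≤ Real.sqrt (M ^ 2 * E) := Real.abs_le_sqrt h1
    _ = M * Real.sqrt E := by rw [Real.sqrt_mul (sq_nonneg M), Real.sqrt_sq hM]

/-- Type-I bound of a pure quadratic term: `-(P S) ≤ L P` for `P ≥ 0`, `|S| ≤ L`. -/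
private lemma rt_quad_le {P S L : ℝ} (hP : 0 ≤ P) (hS : |S| ≤ L) : -(P * S) ≤ L * P := by
  have h1 : -S ≤ L := (neg_le_abs S).trans hS
  nlinarith [mul_le_mul_of_nonneg_left h1 hP]

/-- `d² ≤ e²` from `|d| ≤ e`. -/
private lemma rt_sq_le {d e : ℝ} (h : |d| ≤ e) : d ^ 2 ≤ e ^ 2 :=
  sq_le_sq.2 (h.trans (le_abs_self e))

/-! ### The density pairing `A a'ₗ (…)` -/

/-- **Density pairing at a fixed direction** (helper toward `stub_logBudgetShadowing`, line
`log-lipschitz-budget`, group RT of level 1): `-A x² D` and the `x–vᵢ` cross terms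
`A x vᵢ · 3c₁² dcᵢ` are Type I (`≤ const (K+1) ε ·` energy), while `A x · a S` and `A x · P` are
paired into `(R_v ma + (K+1) R_v c₁⁻² mw) √E`.  Here `c₁ ci = 1`, `A c₁⁴ ≤ (15/2) K ρ` encodes
`A ≍ K/c₁`, `ρ ≍ c₁³`. -/
theorem level1_groupRT_density_pairing_le :
    ∀ (K ε Rv c₁ ci ρ A B a x y D S P N ma mw E : ℝ) (v dc : Fin 3 → ℝ),
      0 ≤ ε → 0 ≤ Rv → 0 < K → c₁ * ci = 1 → 0 < ci → 0 < ρ → 0 < A → 0 ≤ B →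
      A * c₁ ^ 4 ≤ 15 / 2 * K * ρ → |D| ≤ 3 * ε → |S| ≤ 3 * Rv → |P| ≤ 3 * N * Rv →
      (∀ i, |dc i| ≤ ε) → 0 ≤ ma → ma ^ 2 = A * a ^ 2 → 0 ≤ mw → mw ^ 2 = ρ * N ^ 2 →
      1 / 2 * (A * x ^ 2 + ρ * ∑ i, v i ^ 2 + B * y ^ 2) ≤ E →
      A * x * (-(x * D) - a * S - ∑ i, v i * (3 * c₁ ^ 2 * dc i) - P) ≤
        (3 + 9 * (K + 1)) * ε * (A * x ^ 2) + 3 * (K + 1) * ε * (ρ * ∑ i, v i ^ 2) +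
          (5 * Rv * ma + 9 * (K + 1) * Rv * ci ^ 2 * mw) * Real.sqrt E := by
  intro K ε Rv c₁ ci ρ A B a x y D S P N ma mw E v dc hε hRv hK hci hci0 hρ hA hB hAc hD hS hP hdc
    hma0 hma hmw0 hmw hE
  simp only [Fin.sum_univ_three] at hE ⊢
  have pw0 : 0 ≤ ρ * v 0 ^ 2 := by positivity
  have pw1 : 0 ≤ ρ * v 1 ^ 2 := by positivity
  have pw2 : 0 ≤ ρ * v 2 ^ 2 := by positivity
  have pa : 0 ≤ A * x ^ 2 := by positivity
  have pb : 0 ≤ B * y ^ 2 := by positivity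
  have hEa : A * x ^ 2 ≤ 2 * E := by linarith
  -- `-A a'² D₁`
  have hQ1 : -(A * x ^ 2 * D) ≤ 3 * ε * (A * x ^ 2) := rt_quad_le pa hD
  -- the `a'–w'` cross terms
  have hκ : ∀ i, (-(A * (3 * c₁ ^ 2 * dc i))) ^ 2 ≤ (6 * (K + 1) * ε) ^ 2 * A * ρ := by
    intro i
    have hd : dc i ^ 2 ≤ ε ^ 2 := rt_sq_le (hdc i)
    calc (-(A * (3 * c₁ ^ 2 * dc i))) ^ 2 = 9 * A * (A * c₁ ^ 4) * dc i ^ 2 := by ring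
      _ ≤ 9 * A * (15 / 2 * K * ρ) * ε ^ 2 := by gcongr
      _ ≤ (6 * (K + 1) * ε) ^ 2 * A * ρ := by
          have : 0 ≤ A * ρ * ε ^ 2 * (36 * K ^ 2 + 9 / 2 * K + 36) := by positivity
          linarith
  have hQ2 : ∀ i, -(A * (3 * c₁ ^ 2 * dc i)) * x * v i ≤
      6 * (K + 1) * ε * (1 / 2 * (A * x ^ 2 + ρ * v i ^ 2)) := fun i =>
    rt_cross_le hA (by positivity) (hκ i)
  -- `A a' a Σ∂²u₁`
  have hG1 : -(A * a * S) * x ≤ 5 * Rv * ma * Real.sqrt E := by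
    refine rt_forcing_le hA (by positivity) hEa ?_
    have hS2 : S ^ 2 ≤ (3 * Rv) ^ 2 := rt_sq_le hS
    have e1 : (5 * Rv * ma) ^ 2 = 25 * Rv ^ 2 * (A * a ^ 2) := by rw [← hma]; ring
    calc 2 * (-(A * a * S)) ^ 2 = 2 * A * (A * a ^ 2) * S ^ 2 := by ring
      _ ≤ 2 * A * (A * a ^ 2) * (3 * Rv) ^ 2 := by gcongr
      _ ≤ A * (5 * Rv * ma) ^ 2 := by
          rw [e1]
          have : 0 ≤ A * (A * a ^ 2) * Rv ^ 2 := by positivity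
          linarith
  -- `A a' Σ wᵢ ∂∂ρ₁`
  have hG2 : -(A * P) * x ≤ 9 * (K + 1) * Rv * ci ^ 2 * mw * Real.sqrt E := by
    refine rt_forcing_le hA (by positivity) hEa ?_
    have hP2 : P ^ 2 ≤ (3 * N * Rv) ^ 2 := rt_sq_le hP
    have hAci : A ≤ 15 / 2 * K * ρ * ci ^ 4 := by
      have e : A = A * c₁ ^ 4 * ci ^ 4 := by
        rw [show A * c₁ ^ 4 * ci ^ 4 = A * (c₁ * ci) ^ 4 by ring, hci]; ring
      rw [e]; exact mul_le_mul_of_nonneg_right hAc (by positivity)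
    have e1 : (9 * (K + 1) * Rv * ci ^ 2 * mw) ^ 2 =
        81 * (K + 1) ^ 2 * Rv ^ 2 * ci ^ 4 * (ρ * N ^ 2) := by rw [← hmw]; ring
    calc 2 * (-(A * P)) ^ 2 = 2 * A * A * P ^ 2 := by ring
      _ ≤ 2 * A * (15 / 2 * K * ρ * ci ^ 4) * (3 * N * Rv) ^ 2 := by gcongr
      _ ≤ A * (9 * (K + 1) * Rv * ci ^ 2 * mw) ^ 2 := by
          rw [e1]
          have : 0 ≤ A * ρ * ci ^ 4 * N ^ 2 * Rv ^ 2 * (81 * K ^ 2 + 27 * K + 81) := by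
            positivity
          linarith
  linear_combination hQ1 + hQ2 0 + hQ2 1 + hQ2 2 + hG1 + hG2

/-! ### The temperature pairing `B b'ₗ (…)` -/

/-- Temperature pairing, first two terms: the `b'–w'` cross terms are Type I and
`B b' Σ wᵢ ∂∂θ₁` is paired into `m₀ √e₁`. -/
private lemma rt_termT12_le {K Ki ε Rv c₁ ci ρ A B x y Qw N mw E : ℝ} {v dc : Fin 3 → ℝ}
    (hε : 0 ≤ ε) (hRv : 0 ≤ Rv) (hK : 0 < K) (hKi : K * Ki = 1) (hKi0 : 0 < Ki)
    (hci : c₁ * ci = 1) (hci0 : 0 < ci) (hρ : 0 < ρ) (hA : 0 ≤ A) (hB : 0 < B)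
    (hBK2 : B * (K * c₁ ^ 2) ≤ 3 * ρ) (hQ : |Qw| ≤ 3 * N * Rv) (hdc : ∀ i, |dc i| ≤ ε)
    (hmw0 : 0 ≤ mw) (hmw : mw ^ 2 = ρ * N ^ 2)
    (hE : 1 / 2 * (A * x ^ 2 + ρ * ∑ i, v i ^ 2 + B * y ^ 2) ≤ E) :
    B * y * (-(∑ i, v i * (2 * K * c₁ * dc i)) - Qw) ≤
      9 / 2 * (K + 1) * ε * (B * y ^ 2) + 3 / 2 * (K + 1) * ε * (ρ * ∑ i, v i ^ 2) +
        6 * (1 + Ki) * Rv * ci * mw * Real.sqrt E := by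
  simp only [Fin.sum_univ_three] at hE ⊢
  have pw0 : 0 ≤ ρ * v 0 ^ 2 := by positivity
  have pw1 : 0 ≤ ρ * v 1 ^ 2 := by positivity
  have pw2 : 0 ≤ ρ * v 2 ^ 2 := by positivity
  have pa : 0 ≤ A * x ^ 2 := by positivity
  have pb : 0 ≤ B * y ^ 2 := by positivity
  have hEb : B * y ^ 2 ≤ 2 * E := by linarith
  -- the `b'–w'` cross terms
  have hκ : ∀ i, (-(B * (2 * K * c₁ * dc i))) ^ 2 ≤ (3 * (K + 1) * ε) ^ 2 * B * ρ := by
    intro i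
    have hd : dc i ^ 2 ≤ ε ^ 2 := rt_sq_le (hdc i)
    calc (-(B * (2 * K * c₁ * dc i))) ^ 2 = 4 * K * B * (B * (K * c₁ ^ 2)) * dc i ^ 2 := by ring
      _ ≤ 4 * K * B * (3 * ρ) * ε ^ 2 := by gcongr
      _ ≤ (3 * (K + 1) * ε) ^ 2 * B * ρ := by
          have : 0 ≤ B * ρ * ε ^ 2 * (9 * K ^ 2 + 6 * K + 9) := by positivity
          linarith
  have hQ3 : ∀ i, -(B * (2 * K * c₁ * dc i)) * y * v i ≤
      3 * (K + 1) * ε * (1 / 2 * (B * y ^ 2 + ρ * v i ^ 2)) := fun i =>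
    rt_cross_le hB (by positivity) (hκ i)
  -- `B b' Σ wᵢ ∂∂θ₁`
  have hG3 : -(B * Qw) * y ≤ 6 * (1 + Ki) * Rv * ci * mw * Real.sqrt E := by
    refine rt_forcing_le hB (by positivity) hEb ?_
    have hQ2 : Qw ^ 2 ≤ (3 * N * Rv) ^ 2 := rt_sq_le hQ
    have hB' : B ≤ 3 * ρ * (Ki * ci ^ 2) := by
      have e : B = B * (K * c₁ ^ 2) * (Ki * ci ^ 2) := by
        rw [show B * (K * c₁ ^ 2) * (Ki * ci ^ 2) = B * (K * Ki) * (c₁ * ci) ^ 2 by ring, hKi,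
          hci]; ring
      rw [e]; exact mul_le_mul_of_nonneg_right hBK2 (by positivity)
    have e1 : (6 * (1 + Ki) * Rv * ci * mw) ^ 2 =
        36 * (1 + Ki) ^ 2 * Rv ^ 2 * ci ^ 2 * (ρ * N ^ 2) := by rw [← hmw]; ring
    calc 2 * (-(B * Qw)) ^ 2 = 2 * B * B * Qw ^ 2 := by ring
      _ ≤ 2 * B * (3 * ρ * (Ki * ci ^ 2)) * (3 * N * Rv) ^ 2 := by gcongr
      _ ≤ B * (6 * (1 + Ki) * Rv * ci * mw) ^ 2 := by
          rw [e1]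
          have : 0 ≤ B * ρ * ci ^ 2 * N ^ 2 * Rv ^ 2 * (36 * Ki ^ 2 + 18 * Ki + 36) := by
            positivity
          linarith
  linear_combination hQ3 0 + hQ3 1 + hQ3 2 + hG3

/-- Temperature pairing, third term `-(2/3) B b' D₁ (∂θ ζ0 + θ ζ1 ∂ρ/ρ - ∂θ₁)`: after expanding
`∂θ = ∂θ₁ + b'`, `∂ρ = ∂ρ₁ + a'` it consists of the Type-I quadratic terms `ζ0 D₁ · B b'²`,
`ζ1 D₁ · a' b'` and two EOS-defect forcings carrying `ζ0 - 1`, `ζ1 = O(c_Z ρ σ³)`. -/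
private lemma rt_termT3_le {K ε c₁ cZ s3 ρ θ ζ0 ζ1 A B x y dl dθl dρl D E : ℝ}
    (hε : 0 ≤ ε) (hK : 0 < K) (hc₁ : 0 < c₁) (hcZ : 0 ≤ cZ) (hs3 : 0 ≤ s3) (hρ : 0 < ρ)
    (hρhi : ρ ≤ 3 * c₁ ^ 3 / 2) (hA : 0 < A) (hB : 0 < B) (hBK1 : ρ ≤ B * (K * c₁ ^ 2))
    (hBK2 : B * (K * c₁ ^ 2) ≤ 3 * ρ) (hBθ : B * θ / ρ = 3 / 2)
    (hAB : A * B = 3 / 2 * (ζ0 + ζ1)) (hγ : 3 / 4 ≤ ζ0 + ζ1) (hz : |ζ0 - 1| ≤ cZ * (ρ * s3))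
    (hζ1 : |ζ1| ≤ cZ * (ρ * s3)) (hsmall : cZ * (ρ * s3) ≤ 1 / 8) (hD : |D| ≤ 3 * ε)
    (hdl : |dl| ≤ ε) (hdθ : dθl = 2 * K * c₁ * dl + y) (hdρ : dρl = 3 * c₁ ^ 2 * dl + x)
    (hEb : B * y ^ 2 ≤ 2 * E) :
    -(B * y * (2 / 3 * (dθl * ζ0 + θ * (ζ1 / ρ) * dρl - 2 * K * c₁ * dl) * D)) ≤
      9 / 4 * ε * (B * y ^ 2) + ε / 2 * (1 / 2 * (A * x ^ 2 + B * y ^ 2)) +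
        17 * (K + 1) * c₁ ^ 4 * (1 + c₁) * ε ^ 2 * cZ * s3 * Real.sqrt E := by
  subst hdθ hdρ
  obtain ⟨hz1, hz2⟩ := abs_le.1 hz
  have hζ0 : |ζ0| ≤ 9 / 8 := by rw [abs_le]; constructor <;> linarith
  have hdl2 : dl ^ 2 ≤ ε ^ 2 := rt_sq_le hdl
  have hD2 : D ^ 2 ≤ (3 * ε) ^ 2 := rt_sq_le hD
  have hz' : (ζ0 - 1) ^ 2 ≤ (cZ * (ρ * s3)) ^ 2 := rt_sq_le hz
  have hζ1a : ζ1 ^ 2 ≤ (cZ * (ρ * s3)) ^ 2 := rt_sq_le hζ1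
  have hζ1b : ζ1 ^ 2 ≤ (1 / 8) ^ 2 := rt_sq_le (hζ1.trans hsmall)
  -- `ζ0 D₁ · B b'²`
  have hQ4 : -(B * y ^ 2 * (2 / 3 * ζ0 * D)) ≤ 9 / 4 * ε * (B * y ^ 2) := by
    refine rt_quad_le (by positivity) ?_
    calc |2 / 3 * ζ0 * D| = 2 / 3 * |ζ0| * |D| := by
          rw [abs_mul, abs_mul, abs_of_pos (by norm_num : (0 : ℝ) < 2 / 3)]
      _ ≤ 2 / 3 * (9 / 8) * (3 * ε) := by gcongr
      _ = 9 / 4 * ε := by ring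
  -- `ζ1 D₁ · a' b'`
  have hQ5 : -(ζ1 * D) * x * y ≤ ε / 2 * (1 / 2 * (A * x ^ 2 + B * y ^ 2)) := by
    refine rt_cross_le hA (by positivity) ?_
    calc (-(ζ1 * D)) ^ 2 = ζ1 ^ 2 * D ^ 2 := by ring
      _ ≤ (1 / 8) ^ 2 * (3 * ε) ^ 2 := by gcongr
      _ ≤ (ε / 2) ^ 2 * A * B := by
          rw [mul_assoc, hAB]
          nlinarith [mul_le_mul_of_nonneg_left hγ (sq_nonneg ε)]
  -- the `ζ0 - 1` forcing
  have hG5 : -(4 / 3 * K * c₁ * B * dl * (ζ0 - 1) * D) * y ≤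
      9 * (K + 1) * c₁ ^ 4 * (1 + c₁) * ε ^ 2 * cZ * s3 * Real.sqrt E := by
    refine rt_forcing_le hB (by positivity) hEb ?_
    have hρ3 : ρ ^ 3 ≤ (3 * c₁ ^ 3 / 2) ^ 3 := by gcongr
    calc 2 * (-(4 / 3 * K * c₁ * B * dl * (ζ0 - 1) * D)) ^ 2
        = 32 / 9 * K * B * (B * (K * c₁ ^ 2)) * dl ^ 2 * (ζ0 - 1) ^ 2 * D ^ 2 := by ring
      _ ≤ 32 / 9 * K * B * (3 * ρ) * ε ^ 2 * (cZ * (ρ * s3)) ^ 2 * (3 * ε) ^ 2 := by gcongr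
      _ = 96 * K * B * ε ^ 4 * cZ ^ 2 * s3 ^ 2 * ρ ^ 3 := by ring
      _ ≤ 96 * K * B * ε ^ 4 * cZ ^ 2 * s3 ^ 2 * (3 * c₁ ^ 3 / 2) ^ 3 := by gcongr
      _ ≤ B * (9 * (K + 1) * c₁ ^ 4 * (1 + c₁) * ε ^ 2 * cZ * s3) ^ 2 := by
          have : 0 ≤ B * ε ^ 4 * cZ ^ 2 * s3 ^ 2 * c₁ ^ 8 * (81 * K ^ 2 * c₁ ^ 2 +
              162 * K ^ 2 * c₁ + 81 * K ^ 2 + 162 * K * c₁ ^ 2 + 162 * K + 81 * c₁ ^ 2 +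
              162 * c₁ + 81) := by positivity
          linarith
  -- the `ζ1` forcing
  have hG6 : -(ζ1 * (3 * c₁ ^ 2 * dl) * D) * y ≤
      8 * (K + 1) * c₁ ^ 4 * (1 + c₁) * ε ^ 2 * cZ * s3 * Real.sqrt E := by
    refine rt_forcing_le hB (by positivity) hEb ?_
    have hKc : 0 < K * c₁ ^ 2 := by positivity
    refine le_of_mul_le_mul_right ?_ hKc
    calc 2 * (-(ζ1 * (3 * c₁ ^ 2 * dl) * D)) ^ 2 * (K * c₁ ^ 2)
        = 18 * K * c₁ ^ 6 * ζ1 ^ 2 * dl ^ 2 * D ^ 2 := by ring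
      _ ≤ 18 * K * c₁ ^ 6 * (cZ * (ρ * s3)) ^ 2 * ε ^ 2 * (3 * ε) ^ 2 := by gcongr
      _ = 162 * K * c₁ ^ 6 * ε ^ 4 * cZ ^ 2 * s3 ^ 2 * ρ * ρ := by ring
      _ ≤ 162 * K * c₁ ^ 6 * ε ^ 4 * cZ ^ 2 * s3 ^ 2 * (3 * c₁ ^ 3 / 2) *
            (B * (K * c₁ ^ 2)) := by gcongr
      _ ≤ B * (8 * (K + 1) * c₁ ^ 4 * (1 + c₁) * ε ^ 2 * cZ * s3) ^ 2 * (K * c₁ ^ 2) := by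
          have : 0 ≤ B * K * ε ^ 4 * cZ ^ 2 * s3 ^ 2 * c₁ ^ 10 * (64 * K ^ 2 * c₁ ^ 2 +
              128 * K ^ 2 * c₁ + 64 * K ^ 2 + 128 * K * c₁ ^ 2 + 13 * K * c₁ + 128 * K +
              64 * c₁ ^ 2 + 128 * c₁ + 64) := by positivity
          linarith
  linear_combination hG5 + hQ4 + hG6 + hQ5 +
    (-(2 / 3 * ζ1 * D * y * (3 * c₁ ^ 2 * dl + x))) * hBθ

/-- Temperature pairing, fourth term `-(2/3) B b' (θ ζ0 - K c₁²) Σ∂²u₁`: with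
`θ ζ0 - K c₁² = θ (ζ0 - 1) + b` it is a `b–b'` pairing plus an EOS-defect forcing. -/
private lemma rt_termT4_le {K Rv c₁ cZ s3 ρ θ ζ0 B b y S mb E : ℝ}
    (hRv : 0 ≤ Rv) (hK : 0 < K) (hc₁ : 0 < c₁) (hcZ : 0 ≤ cZ) (hs3 : 0 ≤ s3) (hρ : 0 < ρ)
    (hρhi : ρ ≤ 3 * c₁ ^ 3 / 2) (hB : 0 < B) (hBK1 : ρ ≤ B * (K * c₁ ^ 2))
    (hBθ : B * θ = 3 / 2 * ρ) (hz : |ζ0 - 1| ≤ cZ * (ρ * s3)) (hS : |S| ≤ 3 * Rv)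
    (hb : b = θ - K * c₁ ^ 2) (hmb0 : 0 ≤ mb) (hmb : mb ^ 2 = B * b ^ 2)
    (hEb : B * y ^ 2 ≤ 2 * E) :
    -(B * y * (2 / 3 * (θ * ζ0 - K * c₁ ^ 2) * S)) ≤
      (3 * Rv * mb + 4 * (K + 1) * c₁ ^ 5 * (1 + c₁) * cZ * Rv * s3) * Real.sqrt E := by
  have hS2 : S ^ 2 ≤ (3 * Rv) ^ 2 := rt_sq_le hS
  have hz' : (ζ0 - 1) ^ 2 ≤ (cZ * (ρ * s3)) ^ 2 := rt_sq_le hz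
  have hG4a : -(2 / 3 * B * b * S) * y ≤ 3 * Rv * mb * Real.sqrt E := by
    refine rt_forcing_le hB (by positivity) hEb ?_
    have e1 : (3 * Rv * mb) ^ 2 = 9 * Rv ^ 2 * (B * b ^ 2) := by rw [← hmb]; ring
    calc 2 * (-(2 / 3 * B * b * S)) ^ 2 = 8 / 9 * B * (B * b ^ 2) * S ^ 2 := by ring
      _ ≤ 8 / 9 * B * (B * b ^ 2) * (3 * Rv) ^ 2 := by gcongr
      _ ≤ B * (3 * Rv * mb) ^ 2 := by
          rw [e1]
          have : 0 ≤ B * (B * b ^ 2) * Rv ^ 2 := by positivity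
          linarith
  have hG4b : -(ρ * (ζ0 - 1) * S) * y ≤
      4 * (K + 1) * c₁ ^ 5 * (1 + c₁) * cZ * Rv * s3 * Real.sqrt E := by
    refine rt_forcing_le hB (by positivity) hEb ?_
    have hKc : 0 < K * c₁ ^ 2 := by positivity
    refine le_of_mul_le_mul_right ?_ hKc
    calc 2 * (-(ρ * (ζ0 - 1) * S)) ^ 2 * (K * c₁ ^ 2)
        = 2 * K * c₁ ^ 2 * (ζ0 - 1) ^ 2 * S ^ 2 * ρ * ρ := by ring
      _ ≤ 2 * K * c₁ ^ 2 * (cZ * (ρ * s3)) ^ 2 * (3 * Rv) ^ 2 * ρ * (B * (K * c₁ ^ 2)) := by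
          gcongr
      _ = 18 * K ^ 2 * c₁ ^ 4 * cZ ^ 2 * s3 ^ 2 * Rv ^ 2 * B * ρ ^ 3 := by ring
      _ ≤ 18 * K ^ 2 * c₁ ^ 4 * cZ ^ 2 * s3 ^ 2 * Rv ^ 2 * B * (3 * c₁ ^ 3 / 2) ^ 3 := by
          gcongr
      _ ≤ B * (4 * (K + 1) * c₁ ^ 5 * (1 + c₁) * cZ * Rv * s3) ^ 2 * (K * c₁ ^ 2) := by
          have : 0 ≤ K * B * cZ ^ 2 * s3 ^ 2 * Rv ^ 2 * c₁ ^ 12 * (16 * K ^ 2 * c₁ ^ 2 +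
              32 * K ^ 2 * c₁ + 16 * K ^ 2 + 32 * K * c₁ ^ 2 + 13 / 4 * K * c₁ + 32 * K +
              16 * c₁ ^ 2 + 32 * c₁ + 16) := by positivity
          linarith
  linear_combination hG4a + hG4b + (-(2 / 3 * (ζ0 - 1) * S * y)) * hBθ +
    (2 / 3 * B * S * y) * hb

/-- **Temperature pairing at a fixed direction** (helper toward `stub_logBudgetShadowing`, line
`log-lipschitz-budget`, group RT of level 1): with `∂θ = 2Kc₁ dl + y`, `∂ρ = 3c₁² dl + x`
(`dl = dc l`), the pairing `B y (−Σᵢ vᵢ 2Kc₁ dcᵢ − Q − ⅔(∂θ ζ0 + θ ζ1 ∂ρ/ρ − 2Kc₁ dl) D −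
⅔(θ ζ0 − K c₁²) S)` is at most a Type-I multiple of the energy pieces plus
`(R_v- and c_Z σ³-monomials) √E`.  Here `K Ki = 1`, `c₁ ci = 1`, and
`ρ ≤ B K c₁² ≤ 3ρ`, `B θ = 3ρ/2`, `A B = 3(ζ0+ζ1)/2` encode `B ≍ c₁/K`, `θ ≍ K c₁²`. -/
theorem level1_groupRT_temperature_pairing_le :
    ∀ (K Ki ε Rv c₁ ci cZ s3 ρ θ ζ0 ζ1 A B b x y dl dθl dρl D S Qw N mw mb E : ℝ)
      (v dc : Fin 3 → ℝ),
      0 ≤ ε → 0 ≤ Rv → 0 < K → K * Ki = 1 → 0 < Ki → 0 < c₁ → c₁ * ci = 1 → 0 < ci → 0 ≤ cZ →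
      0 ≤ s3 → 0 < ρ → ρ ≤ 3 * c₁ ^ 3 / 2 → 0 < A → 0 < B → ρ ≤ B * (K * c₁ ^ 2) →
      B * (K * c₁ ^ 2) ≤ 3 * ρ → B * θ = 3 / 2 * ρ → A * B = 3 / 2 * (ζ0 + ζ1) →
      3 / 4 ≤ ζ0 + ζ1 → |ζ0 - 1| ≤ cZ * (ρ * s3) → |ζ1| ≤ cZ * (ρ * s3) →
      cZ * (ρ * s3) ≤ 1 / 8 → |D| ≤ 3 * ε → |S| ≤ 3 * Rv → |Qw| ≤ 3 * N * Rv →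
      (∀ i, |dc i| ≤ ε) → |dl| ≤ ε → dθl = 2 * K * c₁ * dl + y → dρl = 3 * c₁ ^ 2 * dl + x →
      b = θ - K * c₁ ^ 2 → 0 ≤ mw → mw ^ 2 = ρ * N ^ 2 → 0 ≤ mb → mb ^ 2 = B * b ^ 2 →
      1 / 2 * (A * x ^ 2 + ρ * ∑ i, v i ^ 2 + B * y ^ 2) ≤ E →
      B * y * (-(∑ i, v i * (2 * K * c₁ * dc i)) - Qw -
          2 / 3 * (dθl * ζ0 + θ * (ζ1 / ρ) * dρl - 2 * K * c₁ * dl) * D -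
          2 / 3 * (θ * ζ0 - K * c₁ ^ 2) * S) ≤
        9 / 2 * (K + 1) * ε * (B * y ^ 2) + 3 / 2 * (K + 1) * ε * (ρ * ∑ i, v i ^ 2) +
          9 / 4 * ε * (B * y ^ 2) + ε / 2 * (1 / 2 * (A * x ^ 2 + B * y ^ 2)) +
          (6 * (1 + Ki) * Rv * ci * mw + 17 * (K + 1) * c₁ ^ 4 * (1 + c₁) * ε ^ 2 * cZ * s3 +
            3 * Rv * mb + 4 * (K + 1) * c₁ ^ 5 * (1 + c₁) * cZ * Rv * s3) * Real.sqrt E := by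
  intro K Ki ε Rv c₁ ci cZ s3 ρ θ ζ0 ζ1 A B b x y dl dθl dρl D S Qw N mw mb E v dc hε hRv hK hKi hKi0
    hc₁ hci hci0 hcZ hs3 hρ hρhi hA hB hBK1 hBK2 hBθ hAB hγ hz hζ1 hsmall hD hS hQ hdc hdl hdθ hdρ
    hb hmw0 hmw hmb0 hmb hE
  have hBθρ : B * θ / ρ = 3 / 2 := by rw [hBθ]; field_simp
  have hEb : B * y ^ 2 ≤ 2 * E := by
    have h1 : 0 ≤ ρ * ∑ i, v i ^ 2 := by positivity
    have h2 : 0 ≤ A * x ^ 2 := by positivity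
    linarith
  have h2 := rt_termT12_le (x := x) (v := v) hε hRv hK hKi hKi0 hci hci0 hρ hA.le hB hBK2 hQ hdc
    hmw0 hmw hE
  have h3 := rt_termT3_le hε hK hc₁ hcZ hs3 hρ hρhi hA hB hBK1 hBK2 hBθρ hAB hγ hz hζ1 hsmall hD hdl
    hdθ hdρ hEb
  have h4 := rt_termT4_le (y := y) hRv hK hc₁ hcZ hs3 hρ hρhi hB hBK1 hBθ hz hS hb hmb0 hmb hEb
  linear_combination h2 + h3 + h4

end Summit.AtomisticToContinuum.HydrodynamicLimit.Theorems
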